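import Summits.MatrixMultiplication.MatrixMultiplication.Theorems.EdgePencilSixthKronecker
import Summits.MatrixMultiplication.MatrixMultiplication.Theorems.EdgePencilHalfTetra

/-!
# The mirror pairing of the sixth-edge rung: `R₄(W_N^{(e²)}) ≤ R₄(X)·R₄(σX) ≤ R₄(X)²`

Support kernel (2/3) for `stmt-MatrixMultiplication-26697` (`TetraExcessZero`), rung side
`stub_sixRungPos` of `Cruxes/TetraExcessZero/Lines/rung_and_chord`; lineage `decomp-mm-lens-6`
generation 31 (NODE-g31 §2); the object `X = halfTetra`, `σX = halfTetraMirror` is in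
`EdgePencilHalfTetra`. NODE-g26 §2 I-R1 `pairing_le`, now proved. No item is added or changed.

THE PAIRING (§3). Edge-wise, `X ⊠ σX` has bond profile `(e², N, N, N, N, d²)` on
`(01,02,03,12,13,23)`: for `e ≤ N`, `d ≤ N ≤ d²` the rung tensor `W_N^{(e²)} = χ[ℓ₀₁ < e²]·T(K₄)_N`
(`EdgePencil.sixTetra`) is a pullback of the Kronecker product along per-edge label embeddings
`Fin N ↪ Fin (N·N)` (`pairEmb`: box permutations on `01` and `23` as in
`EdgePencilSixthKronecker.exists_perm_box`; the slices `[N]×{0}` on `02, 03` and `{0}×[N]` on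
`12, 13`), so
  `R₄(W_N^{(e²)}) ≤ R₄(X_N^{(e,d)}) · R₄(σX_N^{(e,d)}) ≤ R₄(X_N^{(e,d)})²`
(`tensorRankD_sixTetra_le_pair`, `tensorRankD_sixTetra_le_halfTetra_sq`). At the square levels
`N = m²`, `d = m`, `e = ⌈m^δ⌉` (`tensorRankD_sixTetra_sqLevel_le`) this is the finite level of
`χ(δ) ≤ 2ξ(δ)`, `ξ` the exponent of the half-tensor family — the paired form of the rung. The
complementary fact that each half evaluated SEPARATELY is charged the full pendant (`2ξ(δ) ≥ 4 + δ`),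
so that an un-paired certificate of the rung refutes `ω = 2`, is `EdgePencilHalfFloor`.

References: Christandl–Vrana–Zuiddam [ChristandlVranaZuiddam2016] (arXiv:1609.07476) Ex. 1.1.2, §1.1
(graph tensors with non-uniform bonds multiply edge-wise under `⊠`; restriction), §1.2 eq. (flat)
(flattening lower bounds), Prop. 1.1.16 (proof); Bürgisser–Clausen–Shokrollahi
[BurgisserClausenShokrollahi1997] §14.4 (flattenings / substitution lower bounds); Le Gall [LeGall2012]
§1 (`ω(1,1,½) = 2 ⟺ α ≥ 1/2`). No `sorry`, no new axiom, no instance, no notation.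
-/

noncomputable section

set_option linter.dupNamespace false

open Finset Filter Asymptotics Literature.Computability.AlgebraicComplexity
open Summit.MatrixMultiplication.MatrixMultiplication.Theorems.TetrahedronTensor
open Summit.MatrixMultiplication.MatrixMultiplication.Theorems.TetraDiagonal
open Summit.MatrixMultiplication.MatrixMultiplication.Theses.TetrahedronCarving

namespace Summit.MatrixMultiplication.MatrixMultiplication.Theorems.EdgePencil

/-! ## §3 The pairing: `W_N^{(e²)}` is a pullback of `X ⊠ σX` -/

section Pair

variable {F : Type*} [Field F]

/-- The per-edge label embeddings `Fin N → Fin (N·N)` of the pairing (edges `01,02,03,12,13,23`):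
box permutations `σ₁`, `σ₂` (after the level embedding `Fin N ↪ Fin (N·N)`) on the pendant `01` and
on the thinned edge `23`; first-coordinate slices `y ↦ (y,0)` on `02, 03` (the edges alive in `X`),
second-coordinate slices `y ↦ (0,y)` on `12, 13` (the edges alive in `σX`). -/
def pairEmb {N : ℕ} (σ₁ σ₂ : Equiv.Perm (Fin (N * N))) : Fin 6 → Fin N → Fin (N * N) :=
  ![fun y => σ₁ (Fin.castLE (Nat.le_mul_self N) y),
    fun y => finProdFinEquiv (y, (⟨0, Fin.pos y⟩ : Fin N)),
    fun y => finProdFinEquiv (y, (⟨0, Fin.pos y⟩ : Fin N)),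
    fun y => finProdFinEquiv ((⟨0, Fin.pos y⟩ : Fin N), y),
    fun y => finProdFinEquiv ((⟨0, Fin.pos y⟩ : Fin N), y),
    fun y => σ₂ (Fin.castLE (Nat.le_mul_self N) y)]

/-- The pairing embeddings are injective on every edge. -/
theorem pairEmb_injective {N : ℕ} (σ₁ σ₂ : Equiv.Perm (Fin (N * N))) (k : Fin 6) :
    Function.Injective (pairEmb σ₁ σ₂ k) := by
  intro a b h
  fin_cases k
  all_goals simpa [pairEmb, Prod.ext_iff] using h

/-- **The embedding, pointwise.** Relabel the six edges of `T(K₄)_N` by `pairEmb σ₁ σ₂` (box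
permutations `σ₁` for `e × e` on `01`, `σ₂` for `d × d` on `23`, `N ≤ d²`); then the Kronecker product
`X ⊠ σX` (first pair components through `X`, second through `σX`) pulls back to `W_N^{(e²)}`: the
deleted-edge tests of `X` (`12, 13`) and of `σX` (`02, 03`) see the coordinate `0`, the `23`-tests see
the box, the two pendant tests combine to the initial-segment test `ℓ₀₁ < e²`, and the two
tetrahedron factors recombine (`tetra_mul_apply`, `tetra_relabel`).
[cite: ChristandlVranaZuiddam2016, §1.1 (graph tensors multiply under ⊠)] -/
theorem pair_pullback_apply {N e d : ℕ} (hNd : N ≤ d * d)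
    (σ₁ : Equiv.Perm (Fin (N * N)))
    (hσ₁ : ∀ z : Fin (N * N),
      ((((finProdFinEquiv.symm (σ₁ z)).1 : Fin N) : ℕ) < e ∧
          (((finProdFinEquiv.symm (σ₁ z)).2 : Fin N) : ℕ) < e) ↔ (z : ℕ) < e * e)
    (σ₂ : Equiv.Perm (Fin (N * N)))
    (hσ₂ : ∀ z : Fin (N * N),
      ((((finProdFinEquiv.symm (σ₂ z)).1 : Fin N) : ℕ) < d ∧
          (((finProdFinEquiv.symm (σ₂ z)).2 : Fin N) : ℕ) < d) ↔ (z : ℕ) < d * d)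
    (x : Fin 4 → Fin (N ^ 3)) :
    (fun i : Fin 4 → Fin ((N * N) ^ 3) =>
        halfTetra F N e d (fun v => K₁ (i v)) * halfTetraMirror F N e d (fun v => K₂ (i v)))
      (fun v => finFunctionFinEquiv fun j =>
        pairEmb σ₁ σ₂ (vertexLabels (fun k : Fin 6 => k) v j) (finFunctionFinEquiv.symm (x v) j)) =
      sixTetra F N (e * e) x := by
  have v00 : vertexLabels (fun k : Fin 6 => k) 0 0 = 0 := by simp [vertexLabels]
  have v01 : vertexLabels (fun k : Fin 6 => k) 0 1 = 1 := by simp [vertexLabels]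
  have v02 : vertexLabels (fun k : Fin 6 => k) 0 2 = 2 := by simp [vertexLabels]
  have v11 : vertexLabels (fun k : Fin 6 => k) 1 1 = 3 := by simp [vertexLabels]
  have v12 : vertexLabels (fun k : Fin 6 => k) 1 2 = 4 := by simp [vertexLabels]
  have v22 : vertexLabels (fun k : Fin 6 => k) 2 2 = 5 := by simp [vertexLabels]
  -- the deleted-edge tests of `X` (edges `12, 13`: first coordinate `0`)
  have e12 : thinInd F N 1 1 (K₁ (finFunctionFinEquiv fun j =>
      pairEmb σ₁ σ₂ (vertexLabels (fun k : Fin 6 => k) 1 j) (finFunctionFinEquiv.symm (x 1) j))) = 1 := by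
    refine thinInd_eq_one (F := F) ?_
    rw [symm_K₁_apply, Equiv.symm_apply_apply, v11]
    simp [pairEmb]
  have e13 : thinInd F N 1 2 (K₁ (finFunctionFinEquiv fun j =>
      pairEmb σ₁ σ₂ (vertexLabels (fun k : Fin 6 => k) 1 j) (finFunctionFinEquiv.symm (x 1) j))) = 1 := by
    refine thinInd_eq_one (F := F) ?_
    rw [symm_K₁_apply, Equiv.symm_apply_apply, v12]
    simp [pairEmb]
  -- the deleted-edge tests of `σX` (edges `02, 03`: second coordinate `0`)
  have e02 : thinInd F N 1 1 (K₂ (finFunctionFinEquiv fun j =>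
      pairEmb σ₁ σ₂ (vertexLabels (fun k : Fin 6 => k) 0 j) (finFunctionFinEquiv.symm (x 0) j))) = 1 := by
    refine thinInd_eq_one (F := F) ?_
    rw [symm_K₂_apply, Equiv.symm_apply_apply, v01]
    simp [pairEmb]
  have e03 : thinInd F N 1 2 (K₂ (finFunctionFinEquiv fun j =>
      pairEmb σ₁ σ₂ (vertexLabels (fun k : Fin 6 => k) 0 j) (finFunctionFinEquiv.symm (x 0) j))) = 1 := by
    refine thinInd_eq_one (F := F) ?_
    rw [symm_K₂_apply, Equiv.symm_apply_apply, v02]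
    simp [pairEmb]
  -- the `23`-tests see the box of `σ₂` (all `N ≤ d·d` labels lie in it)
  have hbox : ∀ y : Fin N,
      (((finProdFinEquiv.symm (σ₂ (Fin.castLE (Nat.le_mul_self N) y))).1 : Fin N) : ℕ) < d ∧
        (((finProdFinEquiv.symm (σ₂ (Fin.castLE (Nat.le_mul_self N) y))).2 : Fin N) : ℕ) < d := by
    intro y
    refine (hσ₂ _).2 ?_
    rw [Fin.val_castLE]
    exact lt_of_lt_of_le y.isLt hNd
  have e23 : thinInd F N d 2 (K₁ (finFunctionFinEquiv fun j =>
      pairEmb σ₁ σ₂ (vertexLabels (fun k : Fin 6 => k) 2 j) (finFunctionFinEquiv.symm (x 2) j))) = 1 := by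
    refine thinInd_eq_one (F := F) ?_
    rw [symm_K₁_apply, Equiv.symm_apply_apply, v22]
    simpa [pairEmb] using (hbox _).1
  have e23' : thinInd F N d 2 (K₂ (finFunctionFinEquiv fun j =>
      pairEmb σ₁ σ₂ (vertexLabels (fun k : Fin 6 => k) 2 j) (finFunctionFinEquiv.symm (x 2) j))) = 1 := by
    refine thinInd_eq_one (F := F) ?_
    rw [symm_K₂_apply, Equiv.symm_apply_apply, v22]
    simpa [pairEmb] using (hbox _).2
  -- the two pendant tests combine to `ℓ₀₁ < e·e`
  have hind : thinInd F N e 0 (K₁ (finFunctionFinEquiv fun j =>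
        pairEmb σ₁ σ₂ (vertexLabels (fun k : Fin 6 => k) 0 j) (finFunctionFinEquiv.symm (x 0) j))) *
      thinInd F N e 0 (K₂ (finFunctionFinEquiv fun j =>
        pairEmb σ₁ σ₂ (vertexLabels (fun k : Fin 6 => k) 0 j) (finFunctionFinEquiv.symm (x 0) j))) =
      thinInd F N (e * e) 0 (x 0) := by
    simp only [thinInd, symm_K₁_apply, symm_K₂_apply, Equiv.symm_apply_apply, ite_one_zero_mul_ite]
    refine if_congr ?_ rfl rfl
    rw [v00]
    simp only [pairEmb, Matrix.cons_val_zero]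
    rw [hσ₁, Fin.val_castLE]
  -- the tetrahedron factors recombine
  have ht : tetra F N (fun v => K₁ (finFunctionFinEquiv fun j =>
        pairEmb σ₁ σ₂ (vertexLabels (fun k : Fin 6 => k) v j) (finFunctionFinEquiv.symm (x v) j))) *
      tetra F N (fun v => K₂ (finFunctionFinEquiv fun j =>
        pairEmb σ₁ σ₂ (vertexLabels (fun k : Fin 6 => k) v j) (finFunctionFinEquiv.symm (x v) j))) =
      tetra F N x := by
    rw [← tetra_mul_apply (F := F) (fun v => finFunctionFinEquiv fun j =>
        pairEmb σ₁ σ₂ (vertexLabels (fun k : Fin 6 => k) v j) (finFunctionFinEquiv.symm (x v) j)),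
      tetra_relabel _ (pairEmb_injective σ₁ σ₂)]
  simp only [halfTetra, halfTetraMirror, sixTetra]
  rw [e12, e13, e02, e03, e23, e23']
  simp only [mul_one]
  rw [mul_mul_mul_comm, hind, ht]

/-- **The pairing**: `R₄(W_N^{(e²)}) ≤ R₄(X_N^{(e,d)}) · R₄(σX_N^{(e,d)})` for `e ≤ N`,
`d ≤ N ≤ d²` — the products of the legs of two rank-one decompositions decompose `X ⊠ σX`, of which
`W_N^{(e²)}` is a pullback (`pair_pullback_apply`). NODE-g26 §2 I-R1 `pairing_le`, now proved.
[cite: ChristandlVranaZuiddam2016, Prop. 1.1.16 (proof)] -/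
theorem tensorRankD_sixTetra_le_pair {N e d : ℕ} (he : e ≤ N) (hd : d ≤ N) (hNd : N ≤ d * d) :
    tensorRankD (sixTetra F N (e * e)) ≤
      tensorRankD (halfTetra F N e d) * tensorRankD (halfTetraMirror F N e d) := by
  classical
  obtain ⟨σ₁, hσ₁⟩ := exists_perm_box he he
  obtain ⟨σ₂, hσ₂⟩ := exists_perm_box hd hd
  obtain ⟨u₁, hu₁⟩ := exists_rankOne_decomposition_halfTetra (F := F) N e d
  obtain ⟨u₂, hu₂⟩ := exists_rankOne_decomposition_halfTetraMirror (F := F) N e d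
  obtain ⟨u, hu⟩ := exists_rankOne_decomposition_mulK hu₁ hu₂
  have key : sixTetra F N (e * e) = fun x : Fin 4 → Fin (N ^ 3) =>
      (fun i : Fin 4 → Fin ((N * N) ^ 3) =>
        halfTetra F N e d (fun v => K₁ (i v)) * halfTetraMirror F N e d (fun v => K₂ (i v)))
        (fun v => finFunctionFinEquiv fun j =>
          pairEmb σ₁ σ₂ (vertexLabels (fun k : Fin 6 => k) v j) (finFunctionFinEquiv.symm (x v) j)) := by
    funext x
    exact (pair_pullback_apply hNd σ₁ hσ₁ σ₂ hσ₂ x).symm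
  rw [key]
  refine (tensorRankD_pullback_le _ (fun v y => finFunctionFinEquiv fun j =>
      pairEmb σ₁ σ₂ (vertexLabels (fun k : Fin 6 => k) v j) (finFunctionFinEquiv.symm y j))
    ⟨_, fun k => rankOneTensor (u k), fun k => rankOneTensor_mem _, hu⟩).trans ?_
  exact tensorRankD_le_of_eq_sum u hu

/-- **`R₄(W_N^{(e²)}) ≤ R₄(X_N^{(e,d)})²`** (`e ≤ N`, `d ≤ N ≤ d²`): the pairing with the mirror
symmetry `R₄(σX) ≤ R₄(X)`. [cite: ChristandlVranaZuiddam2016, Prop. 1.1.16 (proof)] -/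
theorem tensorRankD_sixTetra_le_halfTetra_sq {N e d : ℕ} (he : e ≤ N) (hd : d ≤ N) (hNd : N ≤ d * d) :
    tensorRankD (sixTetra F N (e * e)) ≤ tensorRankD (halfTetra F N e d) ^ 2 := by
  rw [sq]
  exact (tensorRankD_sixTetra_le_pair he hd hNd).trans
    (Nat.mul_le_mul_left _ (tensorRankD_halfTetraMirror_le N e d))

end Pair

/-! ## §3b The square levels -/

section SqLevel

/-- For `m ≥ 1` and `δ ≤ 2`: `⌈m^δ⌉ ≤ m·m` (the pendant bond fits the square level). -/
theorem ceil_rpow_le_sq {m : ℕ} {δ : ℝ} (hm : 1 ≤ m) (hδ2 : δ ≤ 2) :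
    ⌈(m : ℝ) ^ δ⌉₊ ≤ m * m := by
  have hm1 : (1 : ℝ) ≤ m := by exact_mod_cast hm
  have h : (m : ℝ) ^ δ ≤ (m : ℝ) ^ (2 : ℝ) := Real.rpow_le_rpow_of_exponent_le hm1 hδ2
  have h2 : (m : ℝ) ^ (2 : ℝ) = ((m * m : ℕ) : ℝ) := by
    rw [Real.rpow_two]; push_cast; ring
  rw [h2] at h
  exact Nat.ceil_le.2 h

variable {F : Type*} [Field F]

/-- **The square levels of the pairing**: for `m ≥ 1`, `δ ≤ 2`,
`R₄(W_{m·m}^{(⌈m^δ⌉·⌈m^δ⌉)}) ≤ R₄(X_{m·m}^{(⌈m^δ⌉, m)})²` — the finite level of `χ(δ) ≤ 2ξ(δ)`.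
[cite: ChristandlVranaZuiddam2016, Prop. 1.1.16 (proof)] -/
theorem tensorRankD_sixTetra_sqLevel_le {m : ℕ} {δ : ℝ} (hm : 1 ≤ m) (hδ2 : δ ≤ 2) :
    tensorRankD (sixTetra F (m * m) (⌈(m : ℝ) ^ δ⌉₊ * ⌈(m : ℝ) ^ δ⌉₊)) ≤
      tensorRankD (halfTetra F (m * m) ⌈(m : ℝ) ^ δ⌉₊ m) ^ 2 :=
  tensorRankD_sixTetra_le_halfTetra_sq (ceil_rpow_le_sq hm hδ2) (Nat.le_mul_of_pos_left m hm) le_rfl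

end SqLevel

end Summit.MatrixMultiplication.MatrixMultiplication.Theorems.EdgePencil

end
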